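import Mathlib
import Summits.Ventures.PercRepro2.SwOutJunctionH1Cross
import Summits.Ventures.PercRepro2.SwOutJunctionH1EdgeThm
import Summits.Ventures.PercRepro2.SwOutJunctionH1EdgeExample

/-!
# The cross junction with the edge `h–u` (blind cell PercRepro2, night-4 g29, 2026-08-28;
proofs/NIGHT4-G29.md §8)

g24–g27's cross junction (`CrossJunctionM`: the junction `u`, its h-adjacent neighbours, the
dropped vertices `p i` spanning a cross graph, the mark anywhere) requires `u` not adjacent to `h`
(`hnadj`).  `CrossJunctionE` is the same structure with `hnadj` replaced by «`e₀` is the only edge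
`h–u`».  It satisfies the simple-arm hypothesis (H1) exactly as `CrossJunctionM` does
(`CrossJunctionE.H1`: the neighbour `h` of `u` is alone in its component), so Theorem A with the
edge `h–u` gives the class statement and rows 2′SW-ALL / (SW): `CrossJunctionE.reducible`,
`swAll_of_crossJunctionE`, **`sw_of_crossJunctionE`**.
-/

namespace Summit.Ventures.PercRepro2

namespace LocRows

open Hull

variable {V : Type*} {E : Type*} [Fintype E] [DecidableEq E]

open scoped Classical

variable {ends : E → Sym2 V} {X : Type*} {U : Set V} {h u o : V} {p : X → V} {G : SimpleGraph X}

/-- **A cross junction with the edge `h–u`**: `CrossJunctionM` with «`u` not adjacent to `h`»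
replaced by «`e₀` is the only edge `h–u`» (the h-adjacency clause `hu_adj_h` for the neighbours of
`u` other than `h` and the dropped vertices). -/
structure CrossJunctionE (ends : E → Sym2 V) (U : Set V) (h u : V) (p : X → V)
    (G : SimpleGraph X) (o : V) (e₀ : E) : Prop where
  hne_hu : h ≠ u
  hne_hp : ∀ i, h ≠ p i
  hne_up : ∀ i, u ≠ p i
  p_inj : Function.Injective p
  hhU : h ∈ U
  huU : u ∈ U
  hpU : ∀ i, p i ∈ U
  hloop_h : ∀ e, ends e ≠ s(h, h)
  hloop_u : ∀ e, ends e ≠ s(u, u)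
  /-- the edge `h–u` -/
  he₀ : ends e₀ = s(h, u)
  /-- `e₀` is the only edge `h–u` -/
  huniq : ∀ e, ends e = s(h, u) → e = e₀
  hnadj_p : ∀ i e, ends e ≠ s(h, p i)
  hup : ∀ i, ∃ e, ends e = s(u, p i)
  hcross : ∀ i j, G.Adj i j → ∃ e, ends e = s(p i, p j)
  hcross_adj : ∀ i j e, ends e = s(p i, p j) → G.Adj i j
  hcross_simple : ∀ i j e e', ends e = s(p i, p j) → ends e' = s(p i, p j) → e = e'
  /-- a neighbour of `u` other than `h` and the dropped vertices is adjacent to `h` -/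
  hu_adj_h : ∀ e x, ends e = s(u, x) → x ≠ h → (∀ i, x ≠ p i) → ∃ e', ends e' = s(x, h)
  hp_in : ∀ i e x, ends e = s(p i, x) → x ∈ U → x = u ∨ ∃ j, x = p j
  hout : ∀ x ∈ U, x ≠ h → x ≠ o → x ≠ u →
    (∃ e y, ends e = s(x, y) ∧ y ∉ U) ∨ (∀ e, x ∉ ends e)
  /-- a dropped mark carries an outside edge -/
  hext_o : ∀ i, o = p i → ∃ e y, ends e = s(p i, y) ∧ y ∉ U ∧ y ≠ u ∧ ∀ j, y ≠ p j

omit [Fintype E] [DecidableEq E] in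
/-- A vertex outside `U ∖ {h, u}` is alone in its component of `G[U ∖ {h, u}]`. -/
lemma compU_subset_singleton_of_notMem {q : V} (hq : q ∉ U \ {h, u}) :
    compU ends U h u q ⊆ {q} := by
  refine compU_subset_of_closed {q} rfl ?_
  intro e x y _ hx _ hxS
  rw [Set.mem_singleton_iff] at hxS
  subst hxS
  exact absurd hx hq

omit [Fintype E] [DecidableEq E] in
/-- **Every cross junction with the edge `h–u` satisfies (H1)**: the neighbour `h` of `u` is alone in
its component (it is outside `U ∖ {h, u}`), every other neighbour is adjacent to `h` or a dropped
vertex, whose component consists of dropped vertices, none adjacent to `h`. -/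
theorem CrossJunctionE.H1 {e₀ : E} (hj : CrossJunctionE ends U h u p G o e₀) :
    LocRows.H1 ends U h u := by
  intro e x hex
  by_cases hxh : x = h
  · subst hxh
    right
    intro q hq e' he'
    have hq' : q = x := compU_subset_singleton_of_notMem (by simp) hq
    subst hq'
    exact hj.hloop_h e' he'
  by_cases hxp : ∀ i, x ≠ p i
  · left
    exact hj.hu_adj_h e x hex hxh hxp
  · right
    obtain ⟨i, hi⟩ : ∃ i, x = p i := by
      by_contra hne
      exact hxp fun i h' => hne ⟨i, h'⟩
    subst hi
    intro q hq e' he'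
    have hsub : compU ends U h u (p i) ⊆ Set.range p := by
      refine compU_subset ⟨i, rfl⟩ ?_
      rintro e'' _ y hey ⟨j, rfl⟩ hy
      rcases hj.hp_in j e'' y hey hy.1 with rfl | ⟨k, rfl⟩
      · exact absurd (Or.inr rfl) hy.2
      · exact ⟨k, rfl⟩
    obtain ⟨j, rfl⟩ := hsub hq
    exact hj.hnadj_p j e' he'

/-- **A cross-junction region with the edge `h–u` is a base region of the series reduction**, by
Theorem A with the edge `h–u`. -/
theorem CrossJunctionE.reducible {e₀ : E} (hj : CrossJunctionE ends U h u p G o e₀) {l : V}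
    (hl : l ∉ U) : Reducible l h o ends U :=
  reducible_of_junctionH1_edge hl hj.hne_hu hj.hloop_h hj.hloop_u hj.he₀ hj.huniq hj.hout hj.H1

/-- **Row 2′SW-ALL on every graph with a cross junction adjacent to `h` by a single edge**, the mark
anywhere other than `h`. -/
theorem swAll_of_crossJunctionE {e₀ : E} {l : V} (hlh : l ≠ h)
    (hj : CrossJunctionE ends ({l}ᶜ) h u p G o e₀) : SwAll ends l h o :=
  swAll_of_reducible l h o hlh (hj.reducible (by simp))

/-- **Row (SW) on every graph with a cross junction adjacent to `h` by a single edge**, the mark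
anywhere other than `h`. -/
theorem sw_of_crossJunctionE {e₀ : E} {l : V} (hlh : l ≠ h)
    (hj : CrossJunctionE ends ({l}ᶜ) h u p G o e₀) : Sw ends l h o :=
  sw_of_swAll ends (swAll_of_crossJunctionE hlh hj)

end LocRows

end Summit.Ventures.PercRepro2
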